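import Literature.MathematicalPhysics.QuantumFieldTheory.Balaban1983to89.T4TiltOscillation
import HarnessLib

/-!
# The MIXED second-order trace inequality `|Re tr(A g B h C) − Re tr(A g B C) − Re tr(A B h C) + Re tr(A B C)| ≤ |g − 1|·|h − 1|`

Helper for the organ-tangent lane of crux `FluctuationComparisonRegPrIntL` (stmt-QuantumFields-20520), brick (MH) «the marginal is
H-presentable» (LEAD w3 g25 №3, 2026-08-31): the ONLY analytic input of the bound
`|ΔΔ_{(b,v),(b′,v′)} reTr U(∂p)| ≤ dist1 (e^v) · dist1 (e^{v′}) ≤ 3‖v‖‖v′‖` for two one-bond moves at letters `b, b′` of a plaquette `p`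
is the three-slot generalisation of lit ✓`T4TiltOscillation.ReTrQuad` (`|reTr (g h) − reTr g − reTr h + 1| ≤ dist1 g · dist1 h`):
for unitary words `A, B, C` and group elements `g, h`,
`A g B h C − A g B C − A B h C + A B C = A (g − 1) B (h − 1) C`, whence the bound by `‖g − 1‖_op · ‖h − 1‖_op` in the tree's unitary
model (lit `UnitaryModel`: `dist1 U = ‖U − 1‖` in the L²-operator norm, `reTr U = Re Tr U ∕ n`; lit `MatrixNorms.abs_nReTr_le_opNorm`).
With `B = 1` it is the same-letter case (`b = b′`: the letter's own second difference `x (E − 1)(E′ − 1)`), with `B ≠ 1` the two-letter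
case (`b ≠ b′`); inverted letters use `dist1 g⁻¹ = dist1 g`.  Pure matrix algebra [folklore]; nothing of Bałaban's analysis.

* §1 `nReTr_mixedQuad` — complex `n × n` matrices, any `A B C` (bound carries `‖A‖·‖B‖·‖C‖`).
* §2 `reTr_mixedQuad` — `SU(n)`: `|reTr (A g B h C) − reTr (A g B C) − reTr (A B h C) + reTr (A B C)| ≤ dist1 g · dist1 h`;
  `reTr_mixedQuad_one` — the `B = 1` form.
-/

set_option autoImplicit false

namespace Summit.QuantumFields.YangMills.Theorems.OrganTangentReTrMixedQuad

open Literature.MathematicalPhysics.QuantumFieldTheory.Balaban1983to89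
open Literature.MathematicalPhysics.QuantumFieldTheory.Balaban1983to89.UnitaryModel
open scoped Matrix.Norms.L2Operator

section MatrixLevel

variable {n : Type*} [Fintype n] [DecidableEq n]

/-- §1 THE MIXED SECOND-ORDER TRACE INEQUALITY for complex matrices (normalised real trace, L²-operator norm):
`|nReTr (A g B h C) − nReTr (A g B C) − nReTr (A B h C) + nReTr (A B C)| ≤ ‖A‖·‖g − 1‖·‖B‖·‖h − 1‖·‖C‖`, because
`A g B h C − A g B C − A B h C + A B C = A (g − 1) B (h − 1) C`. [folklore] -/
theorem nReTr_mixedQuad (A g B h C : Matrix n n ℂ) :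
    |nReTr (A * g * B * h * C) - nReTr (A * g * B * C) - nReTr (A * B * h * C) + nReTr (A * B * C)| ≤
      ‖A‖ * opDist1 g * ‖B‖ * opDist1 h * ‖C‖ := by
  have e : nReTr (A * g * B * h * C) - nReTr (A * g * B * C) - nReTr (A * B * h * C) + nReTr (A * B * C) =
      nReTr (A * (g - 1) * B * (h - 1) * C) := by
    have h1 : A * (g - 1) * B * (h - 1) * C = A * g * B * h * C - A * g * B * C - A * B * h * C + A * B * C := by
      noncomm_ring
    rw [h1, T4TiltOscillation.nReTr_add, T4TiltOscillation.nReTr_sub, T4TiltOscillation.nReTr_sub]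
  rw [e, opDist1, opDist1]
  refine (MatrixNorms.abs_nReTr_le_opNorm _).trans ?_
  calc ‖A * (g - 1) * B * (h - 1) * C‖ ≤ ‖A * (g - 1) * B * (h - 1)‖ * ‖C‖ := Matrix.l2_opNorm_mul _ _
    _ ≤ ‖A * (g - 1) * B‖ * ‖h - 1‖ * ‖C‖ := by gcongr; exact Matrix.l2_opNorm_mul _ _
    _ ≤ ‖A * (g - 1)‖ * ‖B‖ * ‖h - 1‖ * ‖C‖ := by gcongr; exact Matrix.l2_opNorm_mul _ _
    _ ≤ ‖A‖ * ‖g - 1‖ * ‖B‖ * ‖h - 1‖ * ‖C‖ := by gcongr; exact Matrix.l2_opNorm_mul _ _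

end MatrixLevel

section GroupLevel

variable {n : Type*} [Fintype n] [DecidableEq n] [Nonempty n]

/-- §2 THE MIXED SECOND-ORDER TRACE INEQUALITY ON `SU(n)` (the tree's `GaugeGroup` instance: `dist1 = ‖· − 1‖_op`, `reTr = Re Tr ∕ n`):
for all `A g B h C ∈ SU(n)`, `|reTr (A g B h C) − reTr (A g B C) − reTr (A B h C) + reTr (A B C)| ≤ dist1 g · dist1 h` — the two-letter
second difference of a Wilson word under multiplicative moves `g`, `h` at two distinct letters. [folklore] -/
theorem reTr_mixedQuad (A g B h C : Matrix.specialUnitaryGroup n ℂ) :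
    |reTr (A * g * B * h * C) - reTr (A * g * B * C) - reTr (A * B * h * C) + reTr (A * B * C)| ≤ dist1 g * dist1 h := by
  have hA : ‖((A : Matrix.specialUnitaryGroup n ℂ) : Matrix n n ℂ)‖ = 1 := norm_of_mem_unitaryGroup A.2.1
  have hB : ‖((B : Matrix.specialUnitaryGroup n ℂ) : Matrix n n ℂ)‖ = 1 := norm_of_mem_unitaryGroup B.2.1
  have hC : ‖((C : Matrix.specialUnitaryGroup n ℂ) : Matrix n n ℂ)‖ = 1 := norm_of_mem_unitaryGroup C.2.1
  have key := nReTr_mixedQuad (A : Matrix n n ℂ) (g : Matrix n n ℂ) (B : Matrix n n ℂ) (h : Matrix n n ℂ) (C : Matrix n n ℂ)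
  rw [hA, hB, hC, one_mul, mul_one, mul_one] at key
  show |nReTr ((A * g * B * h * C : Matrix.specialUnitaryGroup n ℂ) : Matrix n n ℂ) -
      nReTr ((A * g * B * C : Matrix.specialUnitaryGroup n ℂ) : Matrix n n ℂ) -
      nReTr ((A * B * h * C : Matrix.specialUnitaryGroup n ℂ) : Matrix n n ℂ) +
      nReTr ((A * B * C : Matrix.specialUnitaryGroup n ℂ) : Matrix n n ℂ)| ≤
    opDist1 (g : Matrix n n ℂ) * opDist1 (h : Matrix n n ℂ)
  simpa only [Submonoid.coe_mul] using key

/-- §2′ The SAME-LETTER form (`B = 1`): `|reTr (A g h C) − reTr (A g C) − reTr (A h C) + reTr (A C)| ≤ dist1 g · dist1 h` — the letter's own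
second difference `x·(E − 1)(E′ − 1)` when both moves hit the same bond. [folklore] -/
theorem reTr_mixedQuad_one (A g h C : Matrix.specialUnitaryGroup n ℂ) :
    |reTr (A * g * h * C) - reTr (A * g * C) - reTr (A * h * C) + reTr (A * C)| ≤ dist1 g * dist1 h := by
  simpa only [mul_one] using reTr_mixedQuad A g 1 h C

end GroupLevel

end Summit.QuantumFields.YangMills.Theorems.OrganTangentReTrMixedQuad
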